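import Mathlib
import HarnessLib
import Literature.RingTheory.MvPolynomial.VariableIdeals
import Summits.ResolutionOfSingularities.ResolutionOfSingularities.Theorems.WildQuotientsWildQuotientResolutionThirdConeAway
import Summits.ResolutionOfSingularities.ResolutionOfSingularities.Theorems.WildQuotientsWildQuotientResolutionJordanFiveTwistedVertexRadical
import Summits.ResolutionOfSingularities.ResolutionOfSingularities.Theorems.WildQuotientsWildQuotientResolutionJordanFiveTwistedChartFixed
import Summits.ResolutionOfSingularities.ResolutionOfSingularities.Theorems.WildQuotientsWildQuotientResolutionJordanFiveTwistedChartCubic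
import Summits.ResolutionOfSingularities.ResolutionOfSingularities.Theorems.WildQuotientsWildQuotientResolutionJordanFiveTwistedChart
import Summits.ResolutionOfSingularities.ResolutionOfSingularities.Theorems.WildQuotientsWildQuotientResolutionJordanFourHalfChartRing
import Summits.ResolutionOfSingularities.ResolutionOfSingularities.Theorems.WildQuotientsWildQuotientResolutionJordanFourHalfTransport

/-!
# RUNG V5 (J₅), brick HP₁ RING SIDE (3): the ring brick on the `μ₃` chart model
(crux stmt-ResolutionOfSingularities-15640 `WildQuotients.WildQuotientResolution`, line `Sketch`;
chain w45c RUNG V5 `JordanFive.jordanFive_hasResolution_of_bricks`, brick HP₁; res-L1-w45c-plan-1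
NAMED 2026-08-27T11:35:13Z «stub-2 = HP₁ RING SIDE `JordanFive.exists_ringBrick_X1_model` in 036's
H₁ mould»; twin of res-type-036's `JordanFour.exists_ringBrick_T_model` (p510790). [OURS · L1 W4.5c]
— NOT a statement of any manuscript; replaces the role of no printed item. Prover res-L1-w45c-stub-2.)

Data: `L ⊇ k[x]` a localisation at `Q = JordanFour.twistedQ` (a domain), `τ_L` over the translation
`Σ_l : ξ ↦ ξ + l` (`x_c ↦ x_c + x_b`), `E = adjoin (cone_w ∪ {1/Q}) ⊆ L` the `μ₃` chart model
(`cone_w = ThirdCone.cone k n w`, `w(b,a,c,d) = (1,2,1,2)`, passengers `0`; res-L1-w45c-stub-1's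
T5-ii), a ring `C` with `base : k[x] → C`, `eE : C ≃+* E`, `eE (base F) = ψ₅ F`
(`ψ₅ = JordanFive.twistedChart`), and chart ratios `t_j` (`j ≠ 1`) with `base H′² · t_j = base g_j`.
THEN: `R₀ := (Artin–Schreier cone)_Q` — the image `θ(ThirdCone.cone k n w₁)` (`w₁ = w` except
`w₁ c = p`, `θ = JordanFour.substN`: `x_c ↦ x_c^p − x_b^{p−1}x_c`) localised at `Q` —, `J₀ :=` its
vertex ideal, `ψC : R₀ → C` injective with range the `τ_L`-fixed elements
(res-L1-w45c-stub-1 `translate_fixedPoints_inter_cubic_eq`, res-type-087 (G1c)/(G1d)), `J₀` radical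
(prime) with `Bl_{J₀}` regular (THEOREM T3 via `ThirdCone.exists_vertexIdeal_away`, p528792), and
`√(ψC⁻¹⟨base x_a, x_b, x_c, x_d, t_j⟩) = J₀` (`radical_span_twistedVertexX1_eq` + lying over along the
integral extension `E ⊆ L`).
-/

-- single-problem summit: the doubled namespace component `ResolutionOfSingularities` is forced
set_option linter.dupNamespace false

noncomputable section

open MvPolynomial AlgebraicGeometry
open Literature.AlgebraicGeometry.Resolution

namespace Summit.ResolutionOfSingularities.ResolutionOfSingularities.Theorems.WildQuotientResolution.JordanFive

variable (k : Type) [Field k] (n : ℕ) (a b c d e : Fin n)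

/-- **`L = k[x][1/Q]` is integral over the cubic model** `adjoin (cone_w ∪ {1/Q})`: every variable
has its cube in the cone (`3 • w i = 0` in `ZMod 3`). [OURS · L1 W4.5c] [folklore] -/
theorem algebra_isIntegral_of_cubicModel (w : Fin n → ZMod 3) {L : Type} [CommRing L] [Algebra k L]
    [Algebra (MvPolynomial (Fin n) k) L] [IsScalarTower k (MvPolynomial (Fin n) k) L]
    [IsLocalization.Away (JordanFour.twistedQ k n a b d) L] :
    Algebra.IsIntegral (Algebra.adjoin k (algebraMap (MvPolynomial (Fin n) k) L ''
      (ThirdCone.cone k n w : Set (MvPolynomial (Fin n) k)) ∪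
      {IsLocalization.Away.invSelf (S := L) (JordanFour.twistedQ k n a b d)})) L := by
  classical
  set E := Algebra.adjoin k (algebraMap (MvPolynomial (Fin n) k) L ''
      (ThirdCone.cone k n w : Set (MvPolynomial (Fin n) k)) ∪
      {IsLocalization.Away.invSelf (S := L) (JordanFour.twistedQ k n a b d)}) with hE
  refine ⟨fun x => ?_⟩
  have hmemE : ∀ {y : L} (hy : y ∈ E), IsIntegral E y := fun {y} hy =>
    (isIntegral_algebraMap (R := E) (A := L) (x := ⟨y, hy⟩))
  have hX : ∀ i : Fin n, IsIntegral E (algebraMap (MvPolynomial (Fin n) k) L (X i)) := by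
    intro i
    refine IsIntegral.of_pow three_pos ?_
    rw [← map_pow]
    refine hmemE (Algebra.subset_adjoin (Set.mem_union_left _ ⟨X i ^ 3, ?_, rfl⟩))
    rw [SetLike.mem_coe, ThirdCone.mem_cone_iff]
    have h := (isWeightedHomogeneous_X k w i).pow 3
    have h3 : (3 : ℕ) • w i = 0 := by
      rw [nsmul_eq_mul]; exact mul_eq_zero_of_left (by decide) _
    rwa [h3] at h
  have hpoly : ∀ f : MvPolynomial (Fin n) k, IsIntegral E (algebraMap (MvPolynomial (Fin n) k) L f) := by
    intro f
    induction f using MvPolynomial.induction_on with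
    | C r =>
        have : algebraMap (MvPolynomial (Fin n) k) L (C r) = algebraMap k L r := by
          rw [← MvPolynomial.algebraMap_eq, ← IsScalarTower.algebraMap_apply]
        rw [this]
        exact hmemE (Subalgebra.algebraMap_mem E r)
    | add p q hp hq => rw [map_add]; exact hp.add hq
    | mul_X p i hp => rw [map_mul]; exact hp.mul (hX i)
  obtain ⟨m, f, hx⟩ := IsLocalization.Away.surj (JordanFour.twistedQ k n a b d) x
  rw [BlowupExitAway.eq_mul_invSelf_pow_of_mul_pow_eq (JordanFour.twistedQ k n a b d) hx]
  exact (hpoly f).mul ((hmemE (Algebra.subset_adjoin (Set.mem_union_right _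
    (Set.mem_singleton _)))).pow m)

/-- `Q = 1 − 3lA + A²η₁` does not lie in the ideal `⟨x_i : i ∈ s⟩` (its constant term is `1`). [folklore] -/
theorem twistedQ_not_mem_span_X (s : Set (Fin n)) :
    JordanFour.twistedQ k n a b d ∉ Ideal.span (X '' s : Set (MvPolynomial (Fin n) k)) := by
  classical
  intro h
  rw [MvPolynomial.mem_ideal_span_X_image] at h
  have h0 : (0 : Fin n →₀ ℕ) ∈ (JordanFour.twistedQ k n a b d).support := by
    rw [MvPolynomial.mem_support_iff, ← MvPolynomial.constantCoeff_eq]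
    simp [JordanFour.twistedQ]
  obtain ⟨i, -, hi⟩ := h 0 h0
  exact hi rfl

variable (hab : a ≠ b) (hac : a ≠ c) (had : a ≠ d) (hbc : b ≠ c) (hbd : b ≠ d) (hcd : c ≠ d)

include hab hac had hbc hbd hcd in
-- the model types are heavy; the proof is an assembly of landed lemmas
set_option maxHeartbeats 1600000 in
/-- **The ring brick `HP₁` on the chart model** (see the module docstring). [OURS · L1 W4.5c]
[folklore; assembly of landed decls] -/
theorem exists_ringBrick_X1_model (p : ℕ) (hp : p.Prime) (hp5 : 5 ≤ p) [CharP k p]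
    (w : Fin n → ZMod 3) (hwa : w a = 2) (hwb : w b = 1) (hwc : w c = 1) (hwd : w d = 2)
    (hw0 : ∀ i, i ≠ a → i ≠ b → i ≠ c → i ≠ d → w i = 0)
    (w₁ : Fin n → ZMod 3) (hw₁a : w₁ a = 2) (hw₁b : w₁ b = 1) (hw₁c : w₁ c = (p : ZMod 3))
    (hw₁d : w₁ d = 2) (hw₁0 : ∀ i, i ≠ a → i ≠ b → i ≠ c → i ≠ d → w₁ i = 0)
    (τ : MvPolynomial (Fin n) k →ₐ[k] MvPolynomial (Fin n) k)
    (hτc : τ (X c) = X c + X b) (hτ : ∀ i, i ≠ c → τ (X i) = X i)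
    {L : Type} [CommRing L] [IsDomain L] [Algebra k L] [Algebra (MvPolynomial (Fin n) k) L]
    [IsScalarTower k (MvPolynomial (Fin n) k) L] [IsLocalization.Away (JordanFour.twistedQ k n a b d) L]
    (τL : L →ₐ[k] L)
    (hτL : ∀ r, τL (algebraMap (MvPolynomial (Fin n) k) L r) = algebraMap (MvPolynomial (Fin n) k) L (τ r))
    (E : Subalgebra k L)
    (hE : E = Algebra.adjoin k (algebraMap (MvPolynomial (Fin n) k) L ''
      (ThirdCone.cone k n w : Set (MvPolynomial (Fin n) k)) ∪
      {IsLocalization.Away.invSelf (S := L) (JordanFour.twistedQ k n a b d)}))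
    {C : Type} [CommRing C] (base : MvPolynomial (Fin n) k →+* C) (eE : C ≃+* ↥E)
    (hbase : ∀ F, ((eE (base F) : E) : L) = algebraMap (MvPolynomial (Fin n) k) L
      (twistedChart k n a b c d e F))
    (t : {j : Fin 40 // j ≠ 1} → C)
    (ht : ∀ j, base (JordanFour.hPrime k n a b c ^ 2) * t j = base (gens12 k n a b c d j.1)) :
    ∃ (R₀ : Type) (_ : CommRing R₀) (J₀ : Ideal R₀) (ψC : R₀ →+* C),
      Function.Injective ψC ∧ (∀ y, y ∈ ψC.range ↔ τL ((eE y : E) : L) = ((eE y : E) : L)) ∧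
      J₀.IsRadical ∧ Scheme.IsRegular (affineBlowup J₀) ∧
      ((Ideal.span (base '' {X a, X b, X c, X d} ∪ Set.range t)).comap ψC).radical = J₀ := by
  classical
  -- constants
  have h2 : (2 : k) ≠ 0 := JordanFour.two_ne_zero_of_charP k p hp5
  have h3 : (3 : k) ≠ 0 := JordanFour.three_ne_zero_of_charP k p hp5
  have hp2 : 2 ≤ p := by omega
  have hp3 : (p : ZMod 3) ≠ 0 := by
    rw [Ne, ZMod.natCast_eq_zero_iff]
    intro h3p
    have := (Nat.prime_dvd_prime_iff_eq Nat.prime_three hp).mp h3p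
    omega
  set Q := JordanFour.twistedQ k n a b d with hQdef
  have hQne : Q ≠ 0 := by
    intro h
    have := twistedQ_not_mem_span_X k n a b d ∅
    rw [← hQdef, h] at this
    exact this (Ideal.zero_mem _)
  have hinjL : Function.Injective (algebraMap (MvPolynomial (Fin n) k) L) :=
    IsLocalization.injective L (powers_le_nonZeroDivisors_of_noZeroDivisors hQne)
  have hτQ : τ Q = Q := JordanFour.translate_twistedQ k n a b c d τ hτ hac hbc hcd
  -- the Artin–Schreier substitution `θ` and the invariants `ST = θ(cone w₁)`
  set θ := JordanFour.substN k n b c p with hθdef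
  have hθX : ∀ i, i ≠ c → θ (X i) = X i := fun i hi => JordanFour.substN_X_of_ne k n b c p hi
  have hθinj : Function.Injective θ := JordanFour.substN_injective k n b c p hbc hp2
  have hθQ : θ Q = Q := JordanFour.translate_twistedQ k n a b c d θ hθX hac hbc hcd
  have hQw : Q ∈ ThirdCone.cone k n w := isWeightedHomogeneous_twistedQ k n a b d w hwa hwb hwd
  have hQw₁ : Q ∈ ThirdCone.cone k n w₁ := isWeightedHomogeneous_twistedQ k n a b d w₁ hw₁a hw₁b hw₁d
  set ST : Subalgebra k (MvPolynomial (Fin n) k) := (ThirdCone.cone k n w₁).map θ with hSTdef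
  have hQST : Q ∈ ST := ⟨Q, hQw₁, hθQ⟩
  -- stub-1's fixed points: `{f ∈ cone w | τ f = f} = ST`
  have hfix : {f : MvPolynomial (Fin n) k | f ∈ Algebra.adjoin k
      (ThirdCone.cone k n w : Set (MvPolynomial (Fin n) k)) ∧ τ f = f} =
      ↑(Algebra.adjoin k (ST : Set (MvPolynomial (Fin n) k))) := by
    rw [Algebra.adjoin_eq, Algebra.adjoin_eq]
    have h := translate_fixedPoints_inter_cubic_eq k n a b c d hbc τ hτc hτ p hp w hwa hwb hwc hwd hw0
      w₁ hw₁a hw₁b hw₁c hw₁d hw₁0 (ThirdCone.cone k n w₁) (fun P => ThirdCone.mem_cone_iff k n w₁ P)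
    rw [hSTdef, hθdef, JordanFour.substN]
    rw [← h]
    rfl
  -- (G1d) the localised invariants as a subalgebra `A₁ ≤ E` of `L`
  set A₁ := Algebra.adjoin k (algebraMap (MvPolynomial (Fin n) k) L '' (ST : Set (MvPolynomial (Fin n) k)) ∪
      {IsLocalization.Away.invSelf (S := L) Q}) with hA₁def
  have hSTw : ∀ f : MvPolynomial (Fin n) k, f ∈ ST → f ∈ ThirdCone.cone k n w := by
    intro f hf
    have : f ∈ ({f : MvPolynomial (Fin n) k | f ∈ Algebra.adjoin k
        (ThirdCone.cone k n w : Set (MvPolynomial (Fin n) k)) ∧ τ f = f}) := by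
      rw [hfix, Algebra.adjoin_eq]; exact hf
    rw [Algebra.adjoin_eq] at this
    exact this.1
  have hA₁E : A₁ ≤ E := by
    rw [hE]
    refine Algebra.adjoin_mono ?_
    rintro x (⟨f, hf, rfl⟩ | hx)
    · exact Or.inl ⟨f, hSTw f hf, rfl⟩
    · exact Or.inr hx
  have hQE : Q ∈ Algebra.adjoin k (ThirdCone.cone k n w : Set (MvPolynomial (Fin n) k)) := by
    rw [Algebra.adjoin_eq]; exact hQw
  obtain ⟨eG, heG⟩ := BlowupExitAway.exists_ringEquiv_away_adjoin (k := k) (S := L) Q hQne ST hQST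
  -- (G1c) the `τ_L`-fixed elements of `E` are `A₁`
  have hfixL := BlowupExitAway.fixedPoints_adjoin_away_eq (k := k) (S := L) Q hQne τ hτQ τL hτL
    (ThirdCone.cone k n w : Set (MvPolynomial (Fin n) k)) (ST : Set (MvPolynomial (Fin n) k)) hQE hfix
  rw [← hE] at hfixL
  -- the presentation `ψC`
  let ψE : Localization.Away (⟨Q, hQST⟩ : ST) →+* E :=
    (Subalgebra.inclusion hA₁E).toRingHom.comp eG.toRingHom
  let ψC : Localization.Away (⟨Q, hQST⟩ : ST) →+* C := eE.symm.toRingHom.comp ψE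
  have hψC_val : ∀ x, ((eE (ψC x) : E) : L) = (eG x : L) := by
    intro x
    change ((eE (eE.symm (ψE x)) : E) : L) = _
    rw [RingEquiv.apply_symm_apply]
    rfl
  have hψC_inj : Function.Injective ψC :=
    eE.symm.injective.comp ((Subalgebra.inclusion_injective hA₁E).comp eG.injective)
  have hrange : ∀ y, y ∈ ψC.range ↔ τL ((eE y : E) : L) = ((eE y : E) : L) := by
    intro y
    constructor
    · rintro ⟨x, rfl⟩
      rw [hψC_val]
      have hmem : (eG x : L) ∈ {x : L | x ∈ E ∧ τL x = x} := by
        rw [hfixL]; exact (eG x).2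
      exact hmem.2
    · intro hy
      have hmem : ((eE y : E) : L) ∈ {x : L | x ∈ E ∧ τL x = x} := ⟨(eE y).2, hy⟩
      rw [hfixL] at hmem
      obtain ⟨x, hx⟩ := eG.surjective ⟨_, hmem⟩
      refine ⟨x, ?_⟩
      apply eE.injective
      apply Subtype.ext
      rw [hψC_val, hx]
  -- the cone side over THEOREM T3: `R₀` as a localisation of `cone w₁` along `φθ : cone w₁ ≃ ST`
  let φθ : ThirdCone.cone k n w₁ ≃ₐ[k] ST := Subalgebra.equivMapOfInjective _ θ hθinj
  have hφθ : ∀ x : ThirdCone.cone k n w₁, ((φθ x : ST) : MvPolynomial (Fin n) k) = θ x := fun x =>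
    Subalgebra.coe_equivMapOfInjective_apply _ θ hθinj x
  letI algR : Algebra (ThirdCone.cone k n w₁) (Localization.Away (⟨Q, hQST⟩ : ST)) :=
    ((algebraMap ST (Localization.Away (⟨Q, hQST⟩ : ST))).comp
      φθ.toRingEquiv.symm.symm.toRingHom).toAlgebra
  set q₁ : ThirdCone.cone k n w₁ := φθ.toRingEquiv.symm ⟨Q, hQST⟩ with hq₁
  haveI hlocR : IsLocalization.Away q₁ (Localization.Away (⟨Q, hQST⟩ : ST)) := by
    have h := IsLocalization.isLocalization_of_base_ringEquiv
      (Submonoid.powers ((⟨Q, hQST⟩ : ST))) (Localization.Away (⟨Q, hQST⟩ : ST)) φθ.toRingEquiv.symm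
    rw [Submonoid.map_powers] at h
    exact h
  let ι : ThirdCone.cone k n w₁ →+* MvPolynomial (Fin n) k :=
    (θ : MvPolynomial (Fin n) k →+* MvPolynomial (Fin n) k).comp (ThirdCone.cone k n w₁).val.toRingHom
  have hιapp : ∀ x : ThirdCone.cone k n w₁, ι x = θ x := fun x => rfl
  have hιq : ι q₁ = Q := by
    rw [hιapp, ← hφθ, hq₁]
    change ((φθ (φθ.symm ⟨Q, hQST⟩) : ST) : MvPolynomial (Fin n) k) = Q
    rw [AlgEquiv.apply_symm_apply]
  haveI : IsLocalization.Away (ι q₁) L := by rw [hιq]; infer_instance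
  -- `𝔫 = ⟨x_a, x_b, x_c, x_d⟩` in the two spellings
  have hset : {i : Fin n | w₁ i ≠ 0} = ({a, b, c, d} : Set (Fin n)) := by
    ext i
    simp only [Set.mem_setOf_eq, Set.mem_insert_iff, Set.mem_singleton_iff]
    constructor
    · intro hi
      by_contra hnot
      push Not at hnot
      exact hi (hw₁0 i hnot.1 hnot.2.1 hnot.2.2.1 hnot.2.2.2)
    · rintro (rfl | rfl | rfl | rfl)
      · rw [hw₁a]; decide
      · rw [hw₁b]; decide
      · rw [hw₁c]; exact hp3
      · rw [hw₁d]; decide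
  have hN : Ideal.span ((fun i => (X i : MvPolynomial (Fin n) k)) '' {i | w₁ i ≠ 0}) =
      Ideal.span (X '' ({a, b, c, d} : Set (Fin n))) := by rw [hset]
  have hι : Ideal.comap ι (Ideal.span ((fun i => (X i : MvPolynomial (Fin n) k)) '' {i | w₁ i ≠ 0})) =
      ThirdCone.vertexIdeal k n w₁ := by
    refine ThirdCone.comap_comp_val_span_X_eq_vertexIdeal k n w₁ θ (fun i hi => ?_) (fun i hi => ?_)
    · by_cases hic : i = c
      · rw [hic, hθdef, JordanFour.substN_X_self]
        have hc' : (X c : MvPolynomial (Fin n) k) ∈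
            Ideal.span ((fun i => (X i : MvPolynomial (Fin n) k)) '' {i | w₁ i ≠ 0}) :=
          Ideal.subset_span ⟨c, by rw [Set.mem_setOf_eq, hw₁c]; exact hp3, rfl⟩
        exact Ideal.sub_mem _ (Ideal.pow_mem_of_mem _ hc' p hp.pos) (Ideal.mul_mem_left _ _ hc')
      · rw [hθX i hic]; exact Ideal.subset_span ⟨i, hi, rfl⟩
    · have hic : i ≠ c := fun h => by rw [h, hw₁c] at hi; exact hp3 hi
      exact hθX i hic
  have hq₁not : q₁ ∉ ThirdCone.vertexIdeal k n w₁ := by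
    intro hmem
    rw [← hι, Ideal.mem_comap, hιq, hN] at hmem
    exact twistedQ_not_mem_span_X k n a b d _ hmem
  obtain ⟨J₀, hJprime, hJreg, hJcomap⟩ := ThirdCone.exists_vertexIdeal_away k n w₁ ι hι q₁ hq₁not
    (Localization.Away (⟨Q, hQST⟩ : ST)) L
  rw [hN] at hJcomap
  -- the localised inclusion `ψL : R₀ → L` is `eG` followed by the inclusion
  set ψL := IsLocalization.Away.map (Localization.Away (⟨Q, hQST⟩ : ST)) L ι q₁ with hψLdef
  have hψL : ∀ x, ψL x = ((eE (ψC x) : E) : L) := by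
    intro x
    rw [hψC_val]
    have hext : ψL = (A₁.val.toRingHom.comp eG.toRingHom) := by
      refine IsLocalization.ringHom_ext (Submonoid.powers q₁) ?_
      refine RingHom.ext fun f => ?_
      rw [hψLdef, IsLocalization.Away.map, IsLocalization.map_comp, RingHom.comp_apply, hιapp]
      change _ = ((eG (algebraMap ST (Localization.Away (⟨Q, hQST⟩ : ST)) (φθ f)) : L))
      rw [heG, hφθ]
    rw [hext]
    rfl
  -- images of the ratios in `L`
  have hs : (X b : MvPolynomial (Fin n) k) ^ 12 ≠ 0 := pow_ne_zero 12 (X_ne_zero b)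
  have htL : ∀ j : {j : Fin 40 // j ≠ 1}, ((eE (t j) : E) : L) =
      algebraMap (MvPolynomial (Fin n) k) L (twistedCofactor12 k n a b c d j.1) *
        IsLocalization.Away.invSelf (S := L) Q ^ 2 := by
    intro j
    have h := congrArg (fun z => ((eE z : E) : L)) (ht j)
    simp only [map_mul, Subalgebra.coe_mul] at h
    rw [hbase, hbase, map_pow, twistedChart_hPrime k n a b c d e hab hac hbc h2,
      twistedChart_gens12 k n a b c d e hab hac had hbc hbd hcd,
      show ((X b : MvPolynomial (Fin n) k) ^ 6 * Q) ^ 2 = X b ^ 12 * Q ^ 2 by ring, map_mul, map_mul,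
      mul_assoc] at h
    have h' := mul_left_cancel₀ ((map_ne_zero_iff _ hinjL).mpr hs) h
    -- h' : algebraMap (Q^2) * e = algebraMap (q j)
    have hQu : algebraMap (MvPolynomial (Fin n) k) L Q *
        IsLocalization.Away.invSelf (S := L) Q = 1 := IsLocalization.Away.mul_invSelf _
    calc ((eE (t j) : E) : L)
        = (algebraMap (MvPolynomial (Fin n) k) L Q * IsLocalization.Away.invSelf (S := L) Q) ^ 2 *
            ((eE (t j) : E) : L) := by rw [hQu, one_pow, one_mul]
      _ = algebraMap (MvPolynomial (Fin n) k) L (twistedCofactor12 k n a b c d j.1) *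
            IsLocalization.Away.invSelf (S := L) Q ^ 2 := by
          rw [← h', map_pow]; ring
  -- the root-chart ideal and its image in `L`
  set JT := Ideal.span (twistedChart k n a b c d e '' {X a, X b, X c, X d} ∪
      Set.range (fun j : {j : Fin 40 // j ≠ 1} => twistedCofactor12 k n a b c d j.1)) with hJT
  set JL := JT.map (algebraMap (MvPolynomial (Fin n) k) L) with hJL
  set SC : Set C := base '' {X a, X b, X c, X d} ∪ Set.range t with hSC
  have hQu' : IsLocalization.Away.invSelf (S := L) Q * algebraMap (MvPolynomial (Fin n) k) L Q = 1 := by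
    rw [mul_comm]; exact IsLocalization.Away.mul_invSelf _
  have hJ'eq : Ideal.span ((fun z => ((eE z : E) : L)) '' SC) = JL := by
    apply le_antisymm
    · rw [Ideal.span_le]
      rintro _ ⟨z, hz, rfl⟩
      rcases hz with ⟨x, hx, rfl⟩ | ⟨j, rfl⟩
      · change ((eE (base x) : E) : L) ∈ JL
        rw [hbase]
        exact Ideal.mem_map_of_mem _ (Ideal.subset_span (Or.inl ⟨x, hx, rfl⟩))
      · change ((eE (t j) : E) : L) ∈ JL
        rw [htL]
        exact Ideal.mul_mem_right _ _ (Ideal.mem_map_of_mem _ (Ideal.subset_span (Or.inr ⟨j, rfl⟩)))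
    · rw [hJL, Ideal.map_le_iff_le_comap, hJT, Ideal.span_le]
      rintro _ (⟨x, hx, rfl⟩ | ⟨j, rfl⟩)
      · rw [SetLike.mem_coe, Ideal.mem_comap, ← hbase]
        exact Ideal.subset_span ⟨base x, Or.inl ⟨x, hx, rfl⟩, rfl⟩
      · rw [SetLike.mem_coe, Ideal.mem_comap]
        have e1 : algebraMap (MvPolynomial (Fin n) k) L (twistedCofactor12 k n a b c d j.1) =
            ((eE (t j) : E) : L) * algebraMap (MvPolynomial (Fin n) k) L Q ^ 2 := by
          rw [htL, mul_assoc, ← mul_pow, hQu', one_pow, mul_one]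
        rw [e1]
        exact Ideal.mul_mem_right _ _ (Ideal.subset_span ⟨t j, Or.inr ⟨j, rfl⟩, rfl⟩)
  have hJLrad : JL.radical = (Ideal.span (X '' ({a, b, c, d} : Set (Fin n)))).map
      (algebraMap (MvPolynomial (Fin n) k) L) := by
    rw [hJL, ← IsLocalization.map_radical (Submonoid.powers Q), hJT,
      radical_span_twistedVertexX1_eq k n a b c d e hab hac had hbc hbd hcd h2 h3]
  have hSC_JL : ∀ y ∈ Ideal.span SC, ((eE y : E) : L) ∈ JL := by
    intro y hy
    rw [← hJ'eq]
    have : Ideal.map (E.val.toRingHom.comp eE.toRingHom) (Ideal.span SC) =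
        Ideal.span ((fun z => ((eE z : E) : L)) '' SC) := by
      rw [Ideal.map_span]; rfl
    rw [← this]
    exact Ideal.mem_map_of_mem _ hy
  refine ⟨Localization.Away (⟨Q, hQST⟩ : ST), inferInstance, J₀, ψC, hψC_inj, hrange,
    hJprime.isRadical, hJreg, ?_⟩
  -- the radical identity
  apply le_antisymm
  · intro x hx
    obtain ⟨m, hm⟩ := hx
    rw [← hJcomap, Ideal.mem_comap]
    have h1 : ψL (x ^ m) ∈ JL := by
      rw [hψL]
      exact hSC_JL _ (Ideal.mem_comap.mp hm)
    rw [map_pow] at h1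
    have h2' : ψL x ∈ JL.radical := ⟨m, h1⟩
    rwa [hJLrad] at h2'
  · intro x hx
    rw [← hJcomap, Ideal.mem_comap, ← hJLrad, hψL, ← hJ'eq] at hx
    haveI : Algebra.IsIntegral E L := by
      rw [hE]; exact algebra_isIntegral_of_cubicModel k n a b d w (L := L)
    have := JordanFour.mem_radical_span_of_model k E eE SC (ψC x) hx
    rw [← Ideal.comap_radical, Ideal.mem_comap]
    exact this

end Summit.ResolutionOfSingularities.ResolutionOfSingularities.Theorems.WildQuotientResolution.JordanFive

end
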